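import Summits.NavierStokesRegularity.FluidComputer.RowChainStages
import HarnessLib

/-!
# The k53d chain: certified time budget (phase-rate sum, switch offsets, horizon; layer R
# certificate; `pub-fluidc-bp3/R1-DESIGN.md` §11.10)

HONEST FRAMING (cell `pub-fluidc`, blueprint seat bp3, gen 22): low prior, high value-of-information
experiment on Tao's machine paradigm; NOT a claim that NS blows up.

WHAT. One rational fact about the chain of record `RowChain.allRows` and the two switch certificates,
by `native_decide` (`--computational` like the run files; the phase stage `ph'` of every row is
re-evaluated, ≈ 1 min): the accumulated phase-rate slack `∑ₖ ρₖHₖ ≤ 1/600`, the two stage-switch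
re-timing windows `Ds₆₅₆/2^P + Ds₉₈₆/2^P ≤ 1/700`, and the reference horizon
`|∑ₖ Hₖ − 19/20| ≤ 1/1000`. Consumed (cast to `ℝ`) by `RowCircuitTime.lean`: the physical arrival
time `τ` of the exact circuit satisfies `|τ − 0.95| ≤ 1/200`.

[cite: Tao2016AveragedNS, §5.5 Thm 5.3 (5.5)]
-/

namespace Summit.NavierStokesRegularity.FluidComputer

open Literature.Analysis.FluidPDE.FluidComputer

namespace RowChain

open RowCheck RowCheck.RowData RowRun

/-- **Time budget of the k53d chain.** [folklore] -/
theorem time_budgetQ :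
    ∑ k ∈ Finset.range 1066, ((row k).ph'.rho : ℚ) / 2 ^ (row k).P * (row k).Hq ≤ 1 / 600 ∧
    (cert656.Ds : ℚ) / 2 ^ (row 657).P + (cert986.Ds : ℚ) / 2 ^ (row 987).P ≤ 1 / 700 ∧
    |∑ k ∈ Finset.range 1066, (row k).Hq - 19 / 20| ≤ (1 : ℚ) / 1000 := by
  native_decide

end RowChain

end Summit.NavierStokesRegularity.FluidComputer
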